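import Summits.NavierStokesRegularity.OSWSelfSimilar.SheetREnergySpaceOf
import Summits.NavierStokesRegularity.OSWSelfSimilar.SheetRPerturbedSolutionOperator
import Summits.NavierStokesRegularity.OSWSelfSimilar.SheetREvansOdd
import HarnessLib

/-!
# SHEET-ℝ frame, Z3-SR-SPEC S2 (P6): REAL DATA in the weak eigen-language — a real energy-space element `p` solving ONE real weak equation
# `linForm_V(u; v) + ∫ w (K p) v = ∫ w (θ·Re ℓ(u) f_R − u) v` is a weak eigenvector `IsWeakEigen … θ 1 (u + 0·i)` of `A − θℓ(·)f`

HONEST FRAMING (cell ns-blowup GROUP B / zone Z3, case Z3-SR-SPEC, P-list (P6) hypothesis of the S2 kernel assembly `SheetRSpectrumOddAssembly`;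
1-D MODEL certificate frame (viscous gCLM/OSW sheet on the line); not Euler/NS; «violates: none — MODEL»). Nothing here asserts that a profile or an
eigenvector exists; this is the PACKAGING step between cert-5's STRONG ⇒ WEAK transport of the time-shift mode (`SheetRTimeShiftModeWeak`, real
functions) and the complex predicate `SheetREvansOdd.IsWeakEigen` (odd class of `L²_w(ℂ)`):

* `cplx hL p := ⟨ofRealW (ιE p), _⟩ : Wcodd L` — the complex class `u + 0·i` of `p ∈ Esp`; `cplx_ne_zero` (`p ≠ 0 ⇒ cplx p ≠ 0`);
* `reW_ofRealW` / `imW_ofRealW`, `reW_imW_realDatum` — `Re(((t:ℝ):ℂ)•(g + 0i) − (u + 0i)) = t•g − u`, `Im(…) = 0` in `L²_w`;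
* **`isWeakEigen_of_real`** — for REAL `θ`, a real `f_R ∈ L²_w` (`f = f_R + 0i`), a functional `ℓ` real on `cplx p` (`Im ℓ(cplx p) = 0`), and the ONE
  real weak equation `linForm_V(u; v) + ∫ w (K p) v = ∫ w ((θ·Re ℓ(cplx p))•f_R − ιE p) v` on every compactly supported odd energy-class test:
  `IsWeakEigen hL K d V ℓ f θ 1 (cplx p)` (the second, imaginary, equation is the zero-profile identity).
One definition (`cplx`); no named fact.  WHAT THIS IS NOT: not NS; no number of record moves.
-/

noncomputable section

namespace Summit.NavierStokesRegularity.OSWSelfSimilar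
namespace SheetRWeakEigenReal

open _root_.MeasureTheory _root_.Set _root_.Filter _root_.Real SheetRWeakProfilePV SheetRWeakToStrong SheetREnergyClass SheetRWeightedMeasure
  SheetRLinearisedTests SheetREnergySpace SheetRTestSpace SheetRLinearisedFormBounds SheetRSolutionOperator SheetRLinearisedCutoffEnergy
  SheetRResolventPair SheetRComplexPivot SheetRResolventComplex SheetRResolventIdentity SheetRPerturbedUniqueness SheetRPerturbedPair
  SheetRPerturbedResolventC SheetRPerturbedResolventIdentityC SheetROddClass SheetRResolventOddClass SheetRGeneratorOddWeak SheetREvansOdd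
  SheetREnergySpaceOf SheetRPerturbedSolutionOperator Literature.Analysis.OperatorTheory
open scoped Topology ENNReal

variable {L D₀ D₁ V₀ c m : ℝ} {d V : ℝ → ℝ}

/-! ### §1 Real classes inside `L²_w(ℂ)` -/

/-- `Re (g + 0·i) = g`, `Im (g + 0·i) = 0` in `L²_w`. [folklore] -/
theorem reW_imW_ofRealW (g : W L) : reW L (ofRealW L g) = g ∧ imW L (ofRealW L g) = 0 := by
  obtain ⟨h1, h2⟩ := toPair_fst_snd (ofRealW L g)
  rw [(ofPair_inlW g).2] at h1 h2
  exact ⟨by rw [← h1]; exact (inlW_fst_snd g).1, by rw [← h2]; exact (inlW_fst_snd g).2⟩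

/-- **Real datum**: `Re(((t:ℝ):ℂ)•(g + 0i) − (u + 0i)) = t•g − u` and `Im(…) = 0`. [folklore] -/
theorem reW_imW_realDatum (t : ℝ) (g u : W L) :
    reW L (((t : ℝ) : ℂ) • ofRealW L g - ofRealW L u) = t • g - u ∧ imW L (((t : ℝ) : ℂ) • ofRealW L g - ofRealW L u) = 0 := by
  have hs : ((t : ℝ) : ℂ) • ofRealW L g = (t : ℝ) • ofRealW L g := (RCLike.real_smul_eq_coe_smul (K := ℂ) t (ofRealW L g)).symm
  obtain ⟨hg1, hg2⟩ := reW_imW_ofRealW (L := L) g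
  obtain ⟨hu1, hu2⟩ := reW_imW_ofRealW (L := L) u
  rw [hs, map_sub, map_sub, map_smul, map_smul, hg1, hg2, hu1, hu2, smul_zero, sub_zero]
  exact ⟨rfl, rfl⟩

/-- **The complex class `u + 0·i ∈ Wcodd L` of a real energy-space element `p`.** [folklore] -/
def cplx (hL : 0 < L) (p : Esp L hL) : Wcodd L := ⟨ofRealW L (ιE hL p), ofRealW_ιE_mem_Wcodd hL p⟩

/-- Coercion of `cplx`. [folklore] -/
theorem coe_cplx (hL : 0 < L) (p : Esp L hL) : (cplx hL p : Wc L) = ofRealW L (ιE hL p) := rfl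

/-- `cplx p` has energy-space coordinates `(p, 0)`. [folklore] -/
theorem toPair_cplx (hL : 0 < L) (p : Esp L hL) : toPair L (cplx hL p : Wc L) = ιpair hL (WithLp.toLp 2 (p, (0 : Esp L hL))) :=
  toPair_ofRealW_ιE hL p

/-- `p ≠ 0 ⇒ cplx p ≠ 0`. [folklore] -/
theorem cplx_ne_zero (hL : 0 < L) {p : Esp L hL} (hp : p ≠ 0) : cplx hL p ≠ 0 := by
  intro h0
  have h1 : (cplx hL p : Wc L) = 0 := by rw [h0, Submodule.coe_zero]
  have h2 : ιE hL p = 0 := by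
    rw [← (reW_imW_ofRealW (L := L) (ιE hL p)).1, ← coe_cplx hL p, h1, map_zero]
  exact hp (eq_zero_of_ιE_eq_zero hL h2)

/-! ### §2 The packaging: one real weak equation ⇒ `IsWeakEigen` -/

/-- The zero profile's unshifted left-hand side vanishes (scalar). [folklore] -/
theorem scalar_lhs_zero_unshifted (hL : 0 < L) (K : Esp L hL →L[ℝ] W L) (h : GardingDataKC L hL d V K D₀ D₁ V₀ c m) (v v₁ : ℝ → ℝ)
    (hv : IsCompactTest v v₁) :
    linForm L d V (prim (der (0 : Esp L hL))) (der (0 : Esp L hL)) v v₁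
        + ∫ y, (L ^ 2 + y ^ 2) * (((K (0 : Esp L hL) : W L) : ℝ → ℝ) y * v y) = 0 := by
  have e := scalar_lhs_zero hL K h 0 v v₁ hv
  have hV : (fun ξ => V ξ + (0 : ℝ)) = V := funext fun ξ => add_zero _
  rwa [hV] at e

/-- **REAL DATA ⇒ WEAK EIGENVECTOR.**  Let `θ ∈ ℝ`, `f_R ∈ L²_w` real with `f = f_R + 0·i ∈ Wcodd`, `ℓ ∈ (Wcodd L)*` real on `cplx p` (`Im ℓ(cplx p) = 0`),
and let the real energy-space element `p` (profile `u = prim (der p) = ιE p` a.e.) satisfy, on every compactly supported odd energy-class test,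
`linForm_V(u; v) + ∫ w (K p) v = ∫ w ((θ·Re ℓ(cplx p))·f_R − ιE p) v`.  Then `cplx p` is a weak eigenvector of `A − θℓ(·)f` at `σ = 1`:
`IsWeakEigen hL K d V ℓ f θ 1 (cplx p)`. [folklore] -/
theorem isWeakEigen_of_real (hL : 0 < L) (K : Esp L hL →L[ℝ] W L) (h : GardingDataKC L hL d V K D₀ D₁ V₀ c m) (ℓ : Wcodd L →L[ℂ] ℂ)
    {f : Wcodd L} {fR : W L} (hf : (f : Wc L) = ofRealW L fR) (θ : ℝ) (p : Esp L hL) (hℓ : (ℓ (cplx hL p)).im = 0)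
    (hweak : ∀ v v₁ : ℝ → ℝ, IsCompactTest v v₁ →
      linForm L d V (prim (der p)) (der p) v v₁ + (∫ y, (L ^ 2 + y ^ 2) * (((K p : W L) : ℝ → ℝ) y * v y)) =
        ∫ y, (L ^ 2 + y ^ 2) * ((((θ * (ℓ (cplx hL p)).re) • fR - ιE hL p : W L) : ℝ → ℝ) y * v y)) :
    IsWeakEigen hL K d V ℓ f (θ : ℂ) 1 (cplx hL p) := by
  refine ⟨WithLp.toLp 2 (p, (0 : Esp L hL)), toPair_cplx hL p, fun v v₁ hv => ?_⟩
  -- the datum is real: `((θ:ℂ) * ℓ(cplx p)) • f − 1 • cplx p = ((θ·Re ℓ):ℝ:ℂ) • ofRealW f_R − ofRealW (ιE p)`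
  have hℓre : ℓ (cplx hL p) = (((ℓ (cplx hL p)).re : ℝ) : ℂ) := by
    apply Complex.ext
    · simp
    · rw [Complex.ofReal_im]; exact hℓ
  have hdat : ((θ : ℂ) * ℓ (cplx hL p)) • (f : Wc L) - (1 : ℂ) • (cplx hL p : Wc L) =
      (((θ * (ℓ (cplx hL p)).re : ℝ)) : ℂ) • ofRealW L fR - ofRealW L (ιE hL p) := by
    rw [hℓre, ← Complex.ofReal_mul, hf, one_smul, coe_cplx, Complex.ofReal_re]
  obtain ⟨hre, him⟩ := reW_imW_realDatum (L := L) (θ * (ℓ (cplx hL p)).re) fR (ιE hL p)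
  have hPf : (WithLp.toLp 2 (p, (0 : Esp L hL)) : WithLp 2 (Esp L hL × Esp L hL)).fst = p := rfl
  have hPs : (WithLp.toLp 2 (p, (0 : Esp L hL)) : WithLp 2 (Esp L hL × Esp L hL)).snd = 0 := rfl
  rw [hPf, hPs, hdat, hre, him, integral_weight_zeroW hL]
  exact ⟨hweak v v₁ hv, scalar_lhs_zero_unshifted hL K h v v₁ hv⟩

/-- `cplx p ≠ 0` packaged with the eigen-statement: the (P6) hypothesis pair of `SheetRSpectrumOddAssembly` from real data. [folklore] -/
theorem weakEigen_hypothesis_of_real (hL : 0 < L) (K : Esp L hL →L[ℝ] W L) (h : GardingDataKC L hL d V K D₀ D₁ V₀ c m)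
    (ℓ : Wcodd L →L[ℂ] ℂ) {f : Wcodd L} {fR : W L} (hf : (f : Wc L) = ofRealW L fR) (θ : ℝ) {p : Esp L hL} (hp : p ≠ 0)
    (hℓ : (ℓ (cplx hL p)).im = 0)
    (hweak : ∀ v v₁ : ℝ → ℝ, IsCompactTest v v₁ →
      linForm L d V (prim (der p)) (der p) v v₁ + (∫ y, (L ^ 2 + y ^ 2) * (((K p : W L) : ℝ → ℝ) y * v y)) =
        ∫ y, (L ^ 2 + y ^ 2) * ((((θ * (ℓ (cplx hL p)).re) • fR - ιE hL p : W L) : ℝ → ℝ) y * v y)) :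
    cplx hL p ≠ 0 ∧ IsWeakEigen hL K d V ℓ f (θ : ℂ) 1 (cplx hL p) :=
  ⟨cplx_ne_zero hL hp, isWeakEigen_of_real hL K h ℓ hf θ p hℓ hweak⟩

end SheetRWeakEigenReal
end Summit.NavierStokesRegularity.OSWSelfSimilar

end
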